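import Mathlib
import HarnessLib
import Summits.HubbardSuperconductivity.HubbardSuperconductivity.Theorems.FunctionFieldCertificateWindowInfraredBoundReductions
import Summits.HubbardSuperconductivity.HubbardSuperconductivity.Theorems.AposterioriCapRgSsbToEvenTorusLroDoubleCommBound
import Summits.HubbardSuperconductivity.HubbardSuperconductivity.Theorems.WeakCouplingBCSWcbcsSsbToTorusLROMomentClosure
import Summits.HubbardSuperconductivity.HubbardSuperconductivity.Theorems.WeakCouplingBCSWcbcsSsbToTorusLROPairCommutatorBudget
import Literature.MathematicalPhysics.QuantumLattice.TorusPairSusceptibility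
import Literature.MathematicalPhysics.QuantumLattice.DWaveSourceProofs

/-!
# Crux `WindowInfraredBound` (stmt-HubbardSuperconductivity-1089) — reductions II: the two engines that
# deliver the Goldstone shape

Companion of `FunctionFieldCertificateWindowInfraredBoundReductions.lean` (§0–§2 there: the crux in tree
vocabulary, the a-priori Parseval ceiling `T_ε ≤ 32L²`, and `wib_of_goldstoneShape`: a pointwise bound
`S_ψ(m)·|q_m| ≤ A` on the punctured window in every sector ground state implies the crux). Here the two
engines proposed for that pointwise bound are composed, sorry-free, down to ONE open physics input each;
everything else is landed tree mathematics (sibling cruxes `SsbToEvenTorusLro` stmt-1315 and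
`WcbcsSsbToTorusLRO` stmt-2009 built the finite-dimensional machinery for the weaker infrared LEAK
`L⁻² Σ_{window} S_ψ ≤ b`; the crux here is its linear-in-`ε` sharpening, which is exactly exponent ONE).

* §3 ENGINE A — LANDAU / PAIR-YRAST FLOOR AT EXPONENT ONE (`wib_of_pairYrastFloorOne`). Reversed
  Feynman–Bijl (`wib_weight_le_of_floors`, from the landed own-bottom identity
  `WcbcsSsbToTorusLRO.mc_dotProduct_doubleComm_of_eigen`): for `Kψ = Eψ`, floors `c|q|` on the Rayleigh
  quotient of `K - E` at `Δψ` and `Δᴴψ` turn the LANDED double-commutator ceiling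
  `stub_doubleCommBound` (`|Re⟨ψ,[Δ_d(m)ᴴ,[K,Δ_d(m)]]ψ⟩| ≤ C(1+|μ'|)L²`, Tasaki–Watanabe extensivity) into
  `S_ψ(m)·|q_m| ≤ C(1+|μ'|)/c` (`goldstoneShape_of_pairYrastFloor`). OPEN INPUT: the exponent-one pair-yrast
  floor in every sector ground state, for all `(U, δ)` (hypothesis `hY`; the sibling stub
  `SsbToEvenTorusLro.stub_pairYrastFloor` is its `α < 2`, one-`(U,δ,μ)` version).
* §4 ENGINE B — MOMENT METHOD WITH TORUS PAIR STIFFNESS (`wib_of_torusPairStiffness`). The LANDED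
  resolvent-free Pitaevskii–Stringari closure `WcbcsSsbToTorusLRO.stub_momentClosure`
  (`‖Δψ‖² ≤ √((B₁ + B₃B₂)X) + 2gX`, each neighbouring sector measured from its own bottom) with the LANDED
  budgets F1 = `stub_doubleCommBound` (at `μ = 0`) and F2 = `WcbcsSsbToTorusLRO.stub_pairCommutatorBudget`
  gives `S_ψ(m)·|q_m| ≤ √((C₁ + C₃C₂)C_X) + κC_X/π` (`goldstoneShape_of_momentClosure`). OPEN INPUTS: the
  torus pair stiffness `X ≤ C_X L²/|q_m|²` in the variational form (hypothesis `hT`; sibling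
  `WcbcsSsbToTorusLRO.stub_torusPairStiffness`), the charging floor `pairGap ≥ -κ/L` (`hCh`; the crux's
  linear-in-`ε` form needs `O(1/L)`, the leak only `o(1/log L)`), and the provable-now two-particle cost
  `|E(N_L) - E(N_L-2)| ≤ C₃` (`hF3`; sibling `stub_twoParticleCost`).

Both engines are pointwise in `(U, δ)`; neither uses reflection positivity; both FAIL exactly on the
physics that would refute the crux (a pair-density wave with `|Q| → 0`, phase separation into
superconducting puddles, a mesoscopic condensate at `|q| ~ 1/L`). No definition, no named fact, no sorry.

Sources: R. P. Feynman, Phys. Rev. 94 (1954) 262; L. Pitaevskii, S. Stringari, J. Low Temp. Phys. 85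
(1991) 377; T. Kennedy, E. H. Lieb, B. S. Shastry, PRL 61 (1988) 2582; H. Tasaki, H. Watanabe (2021)
(`q = 0` double-commutator method); T. Koma, H. Tasaki, J. Stat. Phys. 76 (1994) 745.
-/

namespace Summit.HubbardSuperconductivity.HubbardSuperconductivity.Theorems

-- summit = problem name (single-conjunct summit, D-0017): `HubbardSuperconductivity` occurs twice in the path
set_option linter.dupNamespace false

open Literature.MathematicalPhysics.QuantumLattice Literature.Probability.LatticeModels Matrix Finset
open scoped ComplexOrder ComplexConjugate
open Summit.HubbardSuperconductivity.HubbardSuperconductivity.Theses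

/-! ## §3 Engine A — the Landau / pair-yrast floor at exponent one -/

section Abstract

variable {n : Type*} [Fintype n]

/-- **Reversed Feynman–Bijl, one-sided.** For a Hermitian `K`, an eigenvector `Kψ = Eψ`, any `A` and a
floor `g > 0` on the Rayleigh quotients of `K - E` at BOTH vectors `Aψ`, `Aᴴψ`, a ceiling
`Re⟨ψ, (Aᴴ[K,A] - [K,A]Aᴴ)ψ⟩ ≤ D` on the double commutator gives `‖Aψ‖² ≤ D / g` (the weight
`‖Aᴴψ‖² ≥ 0` is dropped): a LOWER bound on the energy of the modes is an UPPER bound on their weight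
(Feynman 1954 read backwards; Pitaevskii–Stringari 1991). Uses the landed own-bottom identity
`WcbcsSsbToTorusLRO.mc_dotProduct_doubleComm_of_eigen`.
-- adapted from Cruxes/SsbToEvenTorusLro/Lines/pair_yrast_landau_floor.lean (`weight_le_of_floors`)
[folklore] -/
theorem wib_weight_le_of_floors {K : Matrix n n ℂ} (hK : K.IsHermitian) {ψ : n → ℂ} {E g D : ℝ}
    (hψ : K *ᵥ ψ = (E : ℂ) • ψ) (A : Matrix n n ℂ) (hg : 0 < g)
    (h₁ : (E + g) * (star (A *ᵥ ψ) ⬝ᵥ (A *ᵥ ψ)).re ≤ (star (A *ᵥ ψ) ⬝ᵥ (K *ᵥ (A *ᵥ ψ))).re)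
    (h₂ : (E + g) * (star (Aᴴ *ᵥ ψ) ⬝ᵥ (Aᴴ *ᵥ ψ)).re ≤
      (star (Aᴴ *ᵥ ψ) ⬝ᵥ (K *ᵥ (Aᴴ *ᵥ ψ))).re)
    (hD : (star ψ ⬝ᵥ ((Aᴴ * (K * A - A * K) - (K * A - A * K) * Aᴴ) *ᵥ ψ)).re ≤ D) :
    (star (A *ᵥ ψ) ⬝ᵥ (A *ᵥ ψ)).re ≤ D / g := by
  rw [WcbcsSsbToTorusLRO.mc_dotProduct_doubleComm_of_eigen hK hψ A] at hD
  simp only [Complex.add_re, Complex.sub_re, Complex.re_ofReal_mul] at hD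
  have h0 : 0 ≤ (star (Aᴴ *ᵥ ψ) ⬝ᵥ (Aᴴ *ᵥ ψ)).re :=
    (Complex.nonneg_iff.1 (dotProduct_star_self_nonneg _)).1
  rw [le_div_iff₀ hg]
  nlinarith [h₁, h₂, mul_nonneg hg.le h0]

end Abstract

/-- `|q_m| ≥ 2π/L > 0` away from the zero momentum: for `m ≠ 0` some coordinate has
`|valMinAbs mᵢ| ≥ 1`. [folklore] -/
theorem wib_sq_div_le_momentumNormSq {L : ℕ} [NeZero L] {m : TorusSite 2 L} (hm : m ≠ 0) :
    (2 * Real.pi / (L : ℝ)) ^ 2 ≤ momentumNormSq L m := by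
  rw [momentumNormSq_apply]
  have h1 : (1 : ℝ) ≤ ∑ i, (((m i).valMinAbs : ℤ) : ℝ) ^ 2 := by
    obtain ⟨i, hi⟩ : ∃ i, m i ≠ 0 := by
      by_contra h
      push Not at h
      exact hm (funext h)
    have hv : (m i).valMinAbs ≠ 0 := fun h0 => hi ((ZMod.valMinAbs_eq_zero (m i)).1 h0)
    have hsq : (1 : ℝ) ≤ (((m i).valMinAbs : ℤ) : ℝ) ^ 2 := by
      have habs : (1 : ℤ) ≤ |(m i).valMinAbs| := Int.one_le_abs hv
      have habs' : (1 : ℝ) ≤ |(((m i).valMinAbs : ℤ) : ℝ)| := by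
        rw [← Int.cast_abs]; exact_mod_cast habs
      calc (1 : ℝ) = 1 ^ 2 := by norm_num
        _ ≤ |(((m i).valMinAbs : ℤ) : ℝ)| ^ 2 := pow_le_pow_left₀ zero_le_one habs' 2
        _ = (((m i).valMinAbs : ℤ) : ℝ) ^ 2 := sq_abs _
    exact hsq.trans (Finset.single_le_sum (f := fun j => (((m j).valMinAbs : ℤ) : ℝ) ^ 2)
      (fun j _ => sq_nonneg _) (Finset.mem_univ i))
  calc (2 * Real.pi / (L : ℝ)) ^ 2 = (2 * Real.pi / (L : ℝ)) ^ 2 * 1 := (mul_one _).symm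
    _ ≤ (2 * Real.pi / (L : ℝ)) ^ 2 * ∑ i, (((m i).valMinAbs : ℤ) : ℝ) ^ 2 :=
        mul_le_mul_of_nonneg_left h1 (sq_nonneg _)

/-- `2π/L ≤ |q_m|` for `m ≠ 0`. [folklore] -/
theorem wib_div_le_sqrt_momentumNormSq {L : ℕ} [NeZero L] {m : TorusSite 2 L} (hm : m ≠ 0) :
    2 * Real.pi / (L : ℝ) ≤ Real.sqrt (momentumNormSq L m) := by
  have h0 : 0 ≤ 2 * Real.pi / (L : ℝ) := by positivity
  rw [← Real.sqrt_sq h0]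
  exact Real.sqrt_le_sqrt (wib_sq_div_le_momentumNormSq hm)

/-- **Engine A, one state, one momentum.** Let `ψ` be a normalised `(N, S^z = 0)`-sector ground state of
`H = hubbardTorus 2 L 1 U`, `m ≠ 0`, `Δ = pairFieldAt dWaveFormFactor L m`, and `K = H - μ'N̂` for some
chemical potential `μ'` (so `Kψ = Eψ`, `E = E₀(N) - μ'N`). IF the double commutator obeys the ceiling
`|Re⟨ψ, (Δᴴ[K,Δ] - [K,Δ]Δᴴ)ψ⟩| ≤ C(1+|μ'|)L²⟨ψ,ψ⟩` (the LANDED `stub_doubleCommBound`) and `K - E` has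
the LINEAR LANDAU FLOOR `c|q_m|` as a quadratic form at the two vectors `Δψ ∈ (N-2)`, `Δᴴψ ∈ (N+2)`
(pair-yrast of the torus at total momentum `q_m`, exponent ONE: phase mode / two nodal quasiparticles),
THEN the pair structure factor has the Goldstone shape `S_ψ(m) · |q_m| ≤ C(1+|μ'|)/c`. [folklore] -/
theorem goldstoneShape_of_pairYrastFloor {U : ℝ} {L : ℕ} [NeZero L] {N : ℕ}
    {ψ : Fock (Orb (FermionTorus 2 L))}
    (hψ : IsGroundStateInSector (hubbardTorus 2 L 1 U) N 0 ψ) (hψ1 : star ψ ⬝ᵥ ψ = 1)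
    {m : TorusSite 2 L} {c μ' C : ℝ} (hc : 0 < c) (hm : m ≠ 0)
    (hB : |(star ψ ⬝ᵥ (((pairFieldAt dWaveFormFactor L m)ᴴ *
        (hubbardTorusWith 2 L 1 U μ' * pairFieldAt dWaveFormFactor L m -
          pairFieldAt dWaveFormFactor L m * hubbardTorusWith 2 L 1 U μ') -
        (hubbardTorusWith 2 L 1 U μ' * pairFieldAt dWaveFormFactor L m -
          pairFieldAt dWaveFormFactor L m * hubbardTorusWith 2 L 1 U μ') *
        (pairFieldAt dWaveFormFactor L m)ᴴ) *ᵥ ψ)).re| ≤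
        C * (1 + |μ'|) * (L : ℝ) ^ 2 * (star ψ ⬝ᵥ ψ).re)
    (hY : ∀ E : ℝ, hubbardTorusWith 2 L 1 U μ' *ᵥ ψ = (E : ℂ) • ψ →
      (E + c * Real.sqrt (momentumNormSq L m)) *
          (star (pairFieldAt dWaveFormFactor L m *ᵥ ψ) ⬝ᵥ (pairFieldAt dWaveFormFactor L m *ᵥ ψ)).re ≤
        (star (pairFieldAt dWaveFormFactor L m *ᵥ ψ) ⬝ᵥ
          (hubbardTorusWith 2 L 1 U μ' *ᵥ (pairFieldAt dWaveFormFactor L m *ᵥ ψ))).re ∧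
      (E + c * Real.sqrt (momentumNormSq L m)) *
          (star ((pairFieldAt dWaveFormFactor L m)ᴴ *ᵥ ψ) ⬝ᵥ
            ((pairFieldAt dWaveFormFactor L m)ᴴ *ᵥ ψ)).re ≤
        (star ((pairFieldAt dWaveFormFactor L m)ᴴ *ᵥ ψ) ⬝ᵥ
          (hubbardTorusWith 2 L 1 U μ' *ᵥ ((pairFieldAt dWaveFormFactor L m)ᴴ *ᵥ ψ))).re) :
    pairStructureFactor dWaveFormFactor L ψ m * Real.sqrt (momentumNormSq L m) ≤
      C * (1 + |μ'|) / c := by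
  have hK : (hubbardTorusWith 2 L 1 U μ').IsHermitian := isHermitian_hubbardTorusWith L 1 U μ'
  have hE := sub_smul_totalNumber_mulVec_of_isGroundStateInSector hψ μ'
  rw [← hubbardTorusWith_eq] at hE
  obtain ⟨h₁, h₂⟩ := hY _ hE
  have hpos : 0 < momentumNormSq L m :=
    (momentumNormSq_nonneg m).lt_of_ne' (fun h0 => hm ((momentumNormSq_eq_zero_iff m).1 h0))
  have hq : 0 < Real.sqrt (momentumNormSq L m) := Real.sqrt_pos.2 hpos
  have hg : 0 < c * Real.sqrt (momentumNormSq L m) := mul_pos hc hq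
  have hD : (star ψ ⬝ᵥ (((pairFieldAt dWaveFormFactor L m)ᴴ *
        (hubbardTorusWith 2 L 1 U μ' * pairFieldAt dWaveFormFactor L m -
          pairFieldAt dWaveFormFactor L m * hubbardTorusWith 2 L 1 U μ') -
        (hubbardTorusWith 2 L 1 U μ' * pairFieldAt dWaveFormFactor L m -
          pairFieldAt dWaveFormFactor L m * hubbardTorusWith 2 L 1 U μ') *
        (pairFieldAt dWaveFormFactor L m)ᴴ) *ᵥ ψ)).re ≤ C * (1 + |μ'|) * (L : ℝ) ^ 2 := by
    have := (le_abs_self _).trans hB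
    rwa [hψ1, Complex.one_re, mul_one] at this
  have hw := wib_weight_le_of_floors hK hE (pairFieldAt dWaveFormFactor L m) hg h₁ h₂ hD
  have hL : (0 : ℝ) < (L : ℝ) ^ 2 := by
    have : (0 : ℝ) < L := Nat.cast_pos.2 (Nat.pos_of_ne_zero (NeZero.ne L))
    positivity
  rw [le_div_iff₀ hg] at hw
  rw [pairStructureFactor_apply, div_mul_eq_mul_div, div_le_iff₀ hL, div_mul_eq_mul_div,
    le_div_iff₀ hc]
  calc (star (pairFieldAt dWaveFormFactor L m *ᵥ ψ) ⬝ᵥ (pairFieldAt dWaveFormFactor L m *ᵥ ψ)).re *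
        Real.sqrt (momentumNormSq L m) * c
      = (star (pairFieldAt dWaveFormFactor L m *ᵥ ψ) ⬝ᵥ (pairFieldAt dWaveFormFactor L m *ᵥ ψ)).re *
        (c * Real.sqrt (momentumNormSq L m)) := by ring
    _ ≤ C * (1 + |μ'|) * (L : ℝ) ^ 2 := hw

/-- **Engine A ⇒ the crux.** HYPOTHESIS (the exponent-one pair-yrast floor, for all `(U, δ)`): for all
`U > 0`, `δ ∈ (0,1/2)` there are `c > 0`, `ε₀ > 0`, `M₀` and `L₀` such that for every even `L ≥ L₀`, every
normalised `(N_L, 0)`-sector ground state `ψ` and every `m ≠ 0` with `|q_m| ≤ ε₀` there is a chemical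
potential `|μ'| ≤ M₀` for which `K = H - μ'N̂` exceeds `ψ`'s `K`-eigenvalue by at least `c|q_m|` as a
quadratic form at `Δ_d(m)ψ` and at `Δ_d(m)ᴴψ`. CONCLUSION: `WindowInfraredBound` (constant
`C = 32·C_B(1+|M₀|)/c`, `C_B` from the landed double-commutator bound). The hypothesis is a physics claim
(Landau's criterion for pair excitations at total momentum `q ≠ 0`; linear in a clean superconductor, an
`O(1)` floor for the bulk of the pair weight in a metal) with no finite decidable instance; it FAILS exactly
where the crux is expected to fail (pair-density wave with `|Q| → 0`, phase separation). [folklore] -/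
theorem wib_of_pairYrastFloorOne
    (hY : ∀ U : ℝ, 0 < U → ∀ δ ∈ Set.Ioo (0:ℝ) (1 / 2), ∃ c ε₀ M₀ : ℝ, 0 < c ∧ 0 < ε₀ ∧ ∃ L₀ : ℕ,
      ∀ (L : ℕ) [NeZero L], L₀ ≤ L → Even L → ∀ ψ : Fock (Orb (FermionTorus 2 L)),
        star ψ ⬝ᵥ ψ = 1 →
          IsGroundStateInSector (hubbardTorus 2 L 1 U) (2 * ⌊(1 - δ) * (L : ℝ) ^ 2 / 2⌋₊) 0 ψ →
            ∀ m : TorusSite 2 L, m ≠ 0 → momentumNormSq L m ≤ ε₀ ^ 2 → ∃ μ' : ℝ, |μ'| ≤ M₀ ∧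
              ∀ E : ℝ, hubbardTorusWith 2 L 1 U μ' *ᵥ ψ = (E : ℂ) • ψ →
                (E + c * Real.sqrt (momentumNormSq L m)) *
                    (star (pairFieldAt dWaveFormFactor L m *ᵥ ψ) ⬝ᵥ
                      (pairFieldAt dWaveFormFactor L m *ᵥ ψ)).re ≤
                  (star (pairFieldAt dWaveFormFactor L m *ᵥ ψ) ⬝ᵥ
                    (hubbardTorusWith 2 L 1 U μ' *ᵥ (pairFieldAt dWaveFormFactor L m *ᵥ ψ))).re ∧
                (E + c * Real.sqrt (momentumNormSq L m)) *
                    (star ((pairFieldAt dWaveFormFactor L m)ᴴ *ᵥ ψ) ⬝ᵥ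
                      ((pairFieldAt dWaveFormFactor L m)ᴴ *ᵥ ψ)).re ≤
                  (star ((pairFieldAt dWaveFormFactor L m)ᴴ *ᵥ ψ) ⬝ᵥ
                    (hubbardTorusWith 2 L 1 U μ' *ᵥ ((pairFieldAt dWaveFormFactor L m)ᴴ *ᵥ ψ))).re) :
    FunctionFieldCertificate.WindowInfraredBound := by
  refine wib_of_goldstoneShape fun U hU δ hδ => ?_
  obtain ⟨c, ε₀, M₀, hc, hε₀, L₀, hL⟩ := hY U hU δ hδ
  obtain ⟨C, hC, hB⟩ := stub_doubleCommBound U hU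
  refine ⟨C * (1 + |M₀|) / c, ε₀, by positivity, hε₀, L₀, fun L _ hL₀ hev ψ hψ1 hψ m hm0 hmε => ?_⟩
  obtain ⟨μ', hμ', hfl⟩ := hL L hL₀ hev ψ hψ1 hψ m hm0 hmε
  refine (goldstoneShape_of_pairYrastFloor hψ hψ1 hc hm0 (hB L μ' m ψ) hfl).trans ?_
  refine div_le_div_of_nonneg_right ?_ hc.le
  exact mul_le_mul_of_nonneg_left (by linarith [hμ', le_abs_self M₀]) hC


/-! ## §4 Engine B — the moment method (Pitaevskii–Stringari) with a torus pair-stiffness input -/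

/-- **Engine B, one state, one momentum.** Let `ψ` be a normalised `(N, S^z=0)`-sector ground state of
`H = hubbardTorus 2 L 1 U`, `N ≥ 2`, `m ≠ 0`, `Δ = pairFieldAt dWaveFormFactor L m`, `|q_m|² = momentumNormSq L m`,
`E(M) = minEnergyOn H (szSector M 0)`. IF
(T∓) the variational TORUS PAIR STIFFNESS bound `2Re⟨w, Δψ⟩ - Re⟨w, (H - E(N-2)) w⟩ ≤ C_X L²/|q_m|²` on the
sector `(N-2, 0)` and its twin with `Δᴴψ`, `E(N+2)` on `(N+2, 0)` (optimising over `w`: the static pair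
susceptibility `⟨Δψ, (H - E₋)⁻¹ Δψ⟩ ≤ C_X L²/|q|²`, the Gaussian-domination / Goldstone form),
(F1) `Re⟨ψ, (Δᴴ[H,Δ] - [H,Δ]Δᴴ)ψ⟩ ≤ C₁ L²` (landed `stub_doubleCommBound` at `μ = 0`),
(F2) `|Re⟨ψ, (ΔᴴΔ - ΔΔᴴ)ψ⟩| ≤ C₂ L²` (landed `stub_pairCommutatorBudget`),
(F3) `|E(N) - E(N-2)| ≤ C₃` and (C) the CHARGING FLOOR `pairGap H N ≥ -κ/L`,
THEN (landed `WcbcsSsbToTorusLRO.stub_momentClosure`: `‖Δψ‖² ≤ √((B₁ + B₃B₂)X) + 2gX`) the pair structure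
factor has the Goldstone shape `S_ψ(m)·|q_m| ≤ √((C₁ + C₃C₂)C_X) + κ C_X/π` (the charging term uses
`L|q_m| ≥ 2π`). Pitaevskii–Stringari, J. Low Temp. Phys. 85 (1991) 377. [folklore] -/
theorem goldstoneShape_of_momentClosure {U : ℝ} {L : ℕ} [NeZero L] {N : ℕ} (hN : 2 ≤ N)
    {ψ : Fock (Orb (FermionTorus 2 L))}
    (hψ : IsGroundStateInSector (hubbardTorus 2 L 1 U) N 0 ψ) (hψ1 : star ψ ⬝ᵥ ψ = 1)
    {m : TorusSite 2 L} (hm : m ≠ 0) {C_X C₁ C₂ C₃ κ : ℝ} (hCX : 0 ≤ C_X) (hC₁ : 0 ≤ C₁)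
    (hC₂ : 0 ≤ C₂) (hC₃ : 0 ≤ C₃) (hκ : 0 ≤ κ)
    (hTm : ∀ w : Fock (Orb (FermionTorus 2 L)), w ∈ szSector (Λ := FermionTorus 2 L) (N - 2) 0 →
      2 * (star w ⬝ᵥ (pairFieldAt dWaveFormFactor L m *ᵥ ψ)).re -
        ((star w ⬝ᵥ (hubbardTorus 2 L 1 U *ᵥ w)).re -
          (hubbardTorus 2 L 1 U).minEnergyOn (szSector (N - 2) 0) * (star w ⬝ᵥ w).re) ≤
        C_X * (L : ℝ) ^ 2 / momentumNormSq L m)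
    (hTp : ∀ w : Fock (Orb (FermionTorus 2 L)), w ∈ szSector (Λ := FermionTorus 2 L) (N + 2) 0 →
      2 * (star w ⬝ᵥ ((pairFieldAt dWaveFormFactor L m)ᴴ *ᵥ ψ)).re -
        ((star w ⬝ᵥ (hubbardTorus 2 L 1 U *ᵥ w)).re -
          (hubbardTorus 2 L 1 U).minEnergyOn (szSector (N + 2) 0) * (star w ⬝ᵥ w).re) ≤
        C_X * (L : ℝ) ^ 2 / momentumNormSq L m)
    (hF1 : (star ψ ⬝ᵥ (((pairFieldAt dWaveFormFactor L m)ᴴ *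
        (hubbardTorus 2 L 1 U * pairFieldAt dWaveFormFactor L m -
          pairFieldAt dWaveFormFactor L m * hubbardTorus 2 L 1 U) -
        (hubbardTorus 2 L 1 U * pairFieldAt dWaveFormFactor L m -
          pairFieldAt dWaveFormFactor L m * hubbardTorus 2 L 1 U) *
        (pairFieldAt dWaveFormFactor L m)ᴴ) *ᵥ ψ)).re ≤ C₁ * (L : ℝ) ^ 2)
    (hF2 : |(star ψ ⬝ᵥ (((pairFieldAt dWaveFormFactor L m)ᴴ * pairFieldAt dWaveFormFactor L m -
        pairFieldAt dWaveFormFactor L m * (pairFieldAt dWaveFormFactor L m)ᴴ) *ᵥ ψ)).re| ≤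
        C₂ * (L : ℝ) ^ 2)
    (hF3 : |(hubbardTorus 2 L 1 U).minEnergyOn (szSector N 0) -
        (hubbardTorus 2 L 1 U).minEnergyOn (szSector (N - 2) 0)| ≤ C₃)
    (hC : -(κ / (L : ℝ)) ≤ pairGap (hubbardTorus 2 L 1 U) N) :
    pairStructureFactor dWaveFormFactor L ψ m * Real.sqrt (momentumNormSq L m) ≤
      Real.sqrt ((C₁ + C₃ * C₂) * C_X) + κ * C_X / Real.pi := by
  have hL0 : (0 : ℝ) < L := Nat.cast_pos.2 (Nat.pos_of_ne_zero (NeZero.ne L))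
  have hL2 : (0 : ℝ) < (L : ℝ) ^ 2 := by positivity
  have hQ : 0 < momentumNormSq L m :=
    (momentumNormSq_nonneg m).lt_of_ne' (fun h0 => hm ((momentumNormSq_eq_zero_iff m).1 h0))
  set Q := momentumNormSq L m with hQdef
  set r := Real.sqrt Q with hrdef
  have hr : 0 < r := Real.sqrt_pos.2 hQ
  have hrQ : r ^ 2 = Q := Real.sq_sqrt hQ.le
  have hLr : 2 * Real.pi ≤ (L : ℝ) * r := by
    have h := wib_div_le_sqrt_momentumNormSq (L := L) hm
    rw [div_le_iff₀ hL0] at h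
    linarith [h]
  -- the landed moment closure with `X = C_X L²/Q`, `B₁ = C₁L²`, `B₂ = C₂L²`, `B₃ = C₃`, `g = κ/L`
  have hX : 0 ≤ C_X * (L : ℝ) ^ 2 / Q := by positivity
  have hMC := WcbcsSsbToTorusLRO.stub_momentClosure L U N hN ψ hψ hψ1 m (C_X * (L : ℝ) ^ 2 / Q)
    (C₁ * (L : ℝ) ^ 2) (C₂ * (L : ℝ) ^ 2) C₃ (κ / (L : ℝ)) hX (by positivity) (by positivity) hC₃
    (by positivity) hTm hTp hF1 hF2 hF3 hC
  set s := (star (pairFieldAt dWaveFormFactor L m *ᵥ ψ) ⬝ᵥ (pairFieldAt dWaveFormFactor L m *ᵥ ψ)).re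
    with hsdef
  have hs0 : 0 ≤ s := (Complex.nonneg_iff.1 (dotProduct_star_self_nonneg _)).1
  set a := (C₁ + C₃ * C₂) * C_X with hadef
  have ha : 0 ≤ a := by positivity
  -- simplify the square root: `(B₁ + B₃B₂) X = (√a · L²/r)²`
  have hsq : (C₁ * (L : ℝ) ^ 2 + C₃ * (C₂ * (L : ℝ) ^ 2)) * (C_X * (L : ℝ) ^ 2 / Q) =
      (Real.sqrt a * ((L : ℝ) ^ 2 / r)) ^ 2 := by
    rw [mul_pow, Real.sq_sqrt ha, div_pow, hrQ, hadef]
    field_simp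
  have hsqrt : Real.sqrt ((C₁ * (L : ℝ) ^ 2 + C₃ * (C₂ * (L : ℝ) ^ 2)) * (C_X * (L : ℝ) ^ 2 / Q)) =
      Real.sqrt a * ((L : ℝ) ^ 2 / r) := by
    rw [hsq, Real.sqrt_sq (by positivity)]
  rw [hsqrt] at hMC
  -- `hMC : s ≤ √a L²/r + 2 (κ/L) (C_X L²/Q)`; goal: `s/L² · r ≤ √a + κ C_X/π`
  rw [pairStructureFactor_apply, ← hsdef]
  have hcharge : 2 * (κ / (L : ℝ)) * (C_X * (L : ℝ) ^ 2 / Q) * r / (L : ℝ) ^ 2 ≤ κ * C_X / Real.pi := by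
    -- `= 2κC_X/(L r) ≤ 2κC_X/(2π)`
    have h1 : 2 * (κ / (L : ℝ)) * (C_X * (L : ℝ) ^ 2 / Q) * r / (L : ℝ) ^ 2 =
        2 * κ * C_X / ((L : ℝ) * r) := by
      rw [← hrQ]
      field_simp
    rw [h1, div_le_div_iff₀ (by positivity) Real.pi_pos]
    calc 2 * κ * C_X * Real.pi = κ * C_X * (2 * Real.pi) := by ring
      _ ≤ κ * C_X * ((L : ℝ) * r) := mul_le_mul_of_nonneg_left hLr (by positivity)
  have hLr' : (L : ℝ) ^ 2 / r * (r / (L : ℝ) ^ 2) = 1 := by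
    rw [div_mul_div_comm, mul_comm ((L : ℝ) ^ 2) r, div_self (mul_pos hr hL2).ne']
  have hmain : s / (L : ℝ) ^ 2 * r ≤
      Real.sqrt a + 2 * (κ / (L : ℝ)) * (C_X * (L : ℝ) ^ 2 / Q) * r / (L : ℝ) ^ 2 := by
    have h := mul_le_mul_of_nonneg_right hMC (by positivity : (0:ℝ) ≤ r / (L : ℝ) ^ 2)
    rw [add_mul, mul_assoc (Real.sqrt a), hLr', mul_one] at h
    have e1 : s / (L : ℝ) ^ 2 * r = s * (r / (L : ℝ) ^ 2) := by ring
    have e2 : 2 * (κ / (L : ℝ)) * (C_X * (L : ℝ) ^ 2 / Q) * r / (L : ℝ) ^ 2 =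
        2 * (κ / (L : ℝ)) * (C_X * (L : ℝ) ^ 2 / Q) * (r / (L : ℝ) ^ 2) := by ring
    rw [e1, e2]
    exact h
  linarith [hmain, hcharge]

/-- `N_L = 2⌊(1-δ)L²/2⌋ ≥ 2` for `δ < 1/2` and `L ≥ 2`. [folklore] -/
theorem wib_two_le_summitFilling {δ : ℝ} (hδ : δ ∈ Set.Ioo (0:ℝ) (1 / 2)) {L : ℕ} (hL : 2 ≤ L) :
    2 ≤ 2 * ⌊(1 - δ) * (L : ℝ) ^ 2 / 2⌋₊ := by
  have hL' : (2 : ℝ) ≤ L := by exact_mod_cast hL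
  have h1 : (1 : ℝ) ≤ (1 - δ) * (L : ℝ) ^ 2 / 2 := by
    rw [le_div_iff₀ two_pos]
    nlinarith [hδ.2, hL']
  have h2 : 1 ≤ ⌊(1 - δ) * (L : ℝ) ^ 2 / 2⌋₊ := Nat.le_floor (by exact_mod_cast h1)
  omega

/-- **Engine B ⇒ the crux.** HYPOTHESES, all pointwise in `(U, δ)` and eventually along even sides, for
every normalised `(N_L, 0)`-sector ground state `ψ` of `H = hubbardTorus 2 L 1 U`:
(T) TORUS PAIR STIFFNESS in the variational form at every window momentum `0 < |q_m| ≤ η`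
(`2Re⟨w,Δ_d(m)ψ⟩ - Re⟨w,(H - E(N_L-2))w⟩ ≤ C_X L²/|q_m|²` on `(N_L-2, 0)`, and the twin on `(N_L+2, 0)`) —
the OPEN `O(1)` input, shared in shape with the sibling stub `WcbcsSsbToTorusLRO.stub_torusPairStiffness`;
(Ch) the CHARGING FLOOR `pairGap H N_L ≥ -κ/L` (pair convexity up to `O(1/L)`; physics: `O(1/L²)` expected);
(F3) the TWO-PARTICLE COST `|E(N_L) - E(N_L-2)| ≤ C₃` (provable now, cf. sibling `stub_twoParticleCost`).
The double-commutator budget (F1) and the pair-commutator budget (F2) are the LANDED `stub_doubleCommBound`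
(at `μ = 0`) and `WcbcsSsbToTorusLRO.stub_pairCommutatorBudget`. CONCLUSION: `WindowInfraredBound`.
Pitaevskii–Stringari (1991); Kennedy–Lieb–Shastry (1988) for the shape. [folklore] -/
theorem wib_of_torusPairStiffness
    (hT : ∀ U : ℝ, 0 < U → ∀ δ ∈ Set.Ioo (0:ℝ) (1 / 2), ∃ C_X η : ℝ, 0 ≤ C_X ∧ 0 < η ∧ ∃ L₀ : ℕ,
      ∀ (L : ℕ) [NeZero L], L₀ ≤ L → Even L → ∀ ψ : Fock (Orb (FermionTorus 2 L)),
        star ψ ⬝ᵥ ψ = 1 →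
          IsGroundStateInSector (hubbardTorus 2 L 1 U) (2 * ⌊(1 - δ) * (L : ℝ) ^ 2 / 2⌋₊) 0 ψ →
            ∀ m : TorusSite 2 L, m ≠ 0 → momentumNormSq L m ≤ η ^ 2 →
              (∀ w : Fock (Orb (FermionTorus 2 L)),
                w ∈ szSector (Λ := FermionTorus 2 L) (2 * ⌊(1 - δ) * (L : ℝ) ^ 2 / 2⌋₊ - 2) 0 →
                  2 * (star w ⬝ᵥ (pairFieldAt dWaveFormFactor L m *ᵥ ψ)).re -
                    ((star w ⬝ᵥ (hubbardTorus 2 L 1 U *ᵥ w)).re -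
                      (hubbardTorus 2 L 1 U).minEnergyOn
                        (szSector (2 * ⌊(1 - δ) * (L : ℝ) ^ 2 / 2⌋₊ - 2) 0) * (star w ⬝ᵥ w).re) ≤
                    C_X * (L : ℝ) ^ 2 / momentumNormSq L m) ∧
              (∀ w : Fock (Orb (FermionTorus 2 L)),
                w ∈ szSector (Λ := FermionTorus 2 L) (2 * ⌊(1 - δ) * (L : ℝ) ^ 2 / 2⌋₊ + 2) 0 →
                  2 * (star w ⬝ᵥ ((pairFieldAt dWaveFormFactor L m)ᴴ *ᵥ ψ)).re -
                    ((star w ⬝ᵥ (hubbardTorus 2 L 1 U *ᵥ w)).re -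
                      (hubbardTorus 2 L 1 U).minEnergyOn
                        (szSector (2 * ⌊(1 - δ) * (L : ℝ) ^ 2 / 2⌋₊ + 2) 0) * (star w ⬝ᵥ w).re) ≤
                    C_X * (L : ℝ) ^ 2 / momentumNormSq L m))
    (hCh : ∀ U : ℝ, 0 < U → ∀ δ ∈ Set.Ioo (0:ℝ) (1 / 2), ∃ κ : ℝ, 0 ≤ κ ∧ ∃ L₀ : ℕ,
      ∀ (L : ℕ) [NeZero L], L₀ ≤ L → Even L →
        -(κ / (L : ℝ)) ≤ pairGap (hubbardTorus 2 L 1 U) (2 * ⌊(1 - δ) * (L : ℝ) ^ 2 / 2⌋₊))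
    (hF3 : ∀ U : ℝ, 0 < U → ∀ δ ∈ Set.Ioo (0:ℝ) (1 / 2), ∃ C₃ : ℝ, 0 ≤ C₃ ∧ ∃ L₀ : ℕ,
      ∀ (L : ℕ) [NeZero L], L₀ ≤ L → Even L →
        |(hubbardTorus 2 L 1 U).minEnergyOn (szSector (2 * ⌊(1 - δ) * (L : ℝ) ^ 2 / 2⌋₊) 0) -
          (hubbardTorus 2 L 1 U).minEnergyOn (szSector (2 * ⌊(1 - δ) * (L : ℝ) ^ 2 / 2⌋₊ - 2) 0)| ≤
          C₃) :
    FunctionFieldCertificate.WindowInfraredBound := by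
  refine wib_of_goldstoneShape fun U hU δ hδ => ?_
  obtain ⟨C_X, η, hCX, hη, L₁, hT'⟩ := hT U hU δ hδ
  obtain ⟨κ, hκ, L₂, hCh'⟩ := hCh U hU δ hδ
  obtain ⟨C₃, hC₃, L₃, hF3'⟩ := hF3 U hU δ hδ
  obtain ⟨C, hC, hB⟩ := stub_doubleCommBound U hU
  obtain ⟨B, hB0, hPCB⟩ := WcbcsSsbToTorusLRO.stub_pairCommutatorBudget
  refine ⟨Real.sqrt ((C + C₃ * B) * C_X) + κ * C_X / Real.pi, η, by positivity, hη,
    max (max L₁ L₂) (max L₃ 2), fun L _ hL₀ hev ψ hψ1 hψ m hm0 hmη => ?_⟩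
  have hL₁ : L₁ ≤ L := le_trans (le_max_left _ _) ((le_max_left _ _).trans hL₀)
  have hL₂ : L₂ ≤ L := le_trans (le_max_right _ _) ((le_max_left _ _).trans hL₀)
  have hL₃ : L₃ ≤ L := le_trans (le_max_left _ _) ((le_max_right _ _).trans hL₀)
  have hL2 : 2 ≤ L := le_trans (le_max_right _ _) ((le_max_right _ _).trans hL₀)
  obtain ⟨hTm, hTp⟩ := hT' L hL₁ hev ψ hψ1 hψ m hm0 hmη
  -- (F1) at `μ = 0`
  have hF1 : (star ψ ⬝ᵥ (((pairFieldAt dWaveFormFactor L m)ᴴ *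
        (hubbardTorus 2 L 1 U * pairFieldAt dWaveFormFactor L m -
          pairFieldAt dWaveFormFactor L m * hubbardTorus 2 L 1 U) -
        (hubbardTorus 2 L 1 U * pairFieldAt dWaveFormFactor L m -
          pairFieldAt dWaveFormFactor L m * hubbardTorus 2 L 1 U) *
        (pairFieldAt dWaveFormFactor L m)ᴴ) *ᵥ ψ)).re ≤ C * (L : ℝ) ^ 2 := by
    have h := hB L 0 m ψ
    rw [hubbardTorusWith_zero, hψ1, Complex.one_re, mul_one, abs_zero, add_zero, mul_one] at h
    exact (le_abs_self _).trans h
  -- (F2)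
  have hF2 : |(star ψ ⬝ᵥ (((pairFieldAt dWaveFormFactor L m)ᴴ * pairFieldAt dWaveFormFactor L m -
        pairFieldAt dWaveFormFactor L m * (pairFieldAt dWaveFormFactor L m)ᴴ) *ᵥ ψ)).re| ≤
        B * (L : ℝ) ^ 2 := by
    have h := hPCB L m ψ
    rwa [hψ1, Complex.one_re, mul_one] at h
  exact goldstoneShape_of_momentClosure (wib_two_le_summitFilling hδ hL2) hψ hψ1 hm0 hCX hC hB0 hC₃ hκ
    hTm hTp hF1 hF2 (hF3' L hL₃ hev) (hCh' L hL₂ hev)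

end Summit.HubbardSuperconductivity.HubbardSuperconductivity.Theorems
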